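import Summits.Ventures.YMGap.RobustBall.LangevinPoincare
import Summits.Ventures.YMGap.RobustBall.HeatBathPoincareBall
import Summits.Ventures.YMGap.RobustBall.VarianceTiltTools
import HarnessLib

/-!
# Robust ball (Y2) — THE LANGEVIN (GRADIENT-FORM) POINCARÉ INEQUALITY UNIFORMLY ON THE TORUS BALL AND IN THE VOLUME, EVERY DIMENSION

HONEST FRAMING: venture file of the cell `pub-ymgap` (QuantumFields programme), track ROBUST-BALL, seat rb-p2 (g13); the BALL-UNIFORM, every-`d`
version of `LangevinPoincare.lean` (Wilson, `d = 4`) on top of `HeatBathPoincareBall.lean`.  LATTICE statements at STRONG COUPLING for the torus measures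
`μ_{β,W,L} = Z⁻¹ e^{−β S_W − W} ∏ dU_e` of the MEMBERS `W` of the cell's ball of perturbed `SU(N)` lattice gauge actions (per-link loads of a `LoadWitness`:
oscillation `a(e) ≤ ε₀`, self-Lipschitz `ℓ_s(e) ≤ ε₁`, COLUMN cross-Lipschitz `∑_{e≠y} ℓ(e,y) ≤ ε₂`), on `(ℤ/L)^d`, `L ≥ 2`, constants independent of `L`
and of the member; the member's OWN measure appears; nothing about `β → ∞`, the continuum or Clay.

THE STATEMENT (★★★ `variance_le_integral_Gam_onBall`, `d ≥ 1`): tree coupling `β`, `(|β|/N)·2(d−1) ≤ R`, `OneLinkKRModulus N R K`,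
`c := K e^{ε₀}(1 + 2√N ε₁)(|β|/N)·6(d−1) + √N ε₂ < 1`, `K₀ := N/2 − 2(d−1)|β| > 0`: for EVERY such member, every torus side `L ≥ 2` and every smooth `f`
of the link matrices, `Var_{μ_{β,W,L}}(f) ≤ e^{ε₀} ((1 − c) K₀)⁻¹ ∫ Γ(f,f) dμ_{β,W,L}` (`Γ = LatticeBakryEmery.Gam`, Shen–Zhu–Zhu's (3.7)): the Langevin
dynamics of every member has a spectral gap `≥ e^{−ε₀}(1 − c)K₀` uniformly in the volume.  ★★ `variance_le_integral_Gam_dim`: the WILSON action in EVERY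
dimension (zero member; `LangevinPoincare.lean` is `d = 4`); ★★ `su2_variance_le_integral_Gam_dim3`: `SU(2)`, `d = 3`, HYPOTHESIS-FREE on `0 ≤ β_W < 1/3`,
constant `((1 − 3β_W)(1 − 2β_W))⁻¹` (the Bakry–Émery window for `d = 3` is `β_W < 1/6`); ★★ `su2_variance_le_integral_Gam_onBall` (`SU(2)`, `d = 4`, quarter
modulus, `c = (9β_W/2)e^{ε₀}(1 + 2√2 ε₁) + √2 ε₂`, `K₀ = 1 − 3β_W`); ★★ `su2_variance_le_integral_Gam_onBall_oneEighth`: sprint per-link loads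
`(1/100, 1/500, 1/500)`, EVERY `0 ≤ β_W ≤ 1/8`, EVERY member, EVERY torus: `Var ≤ (65/16) ∫ Γ(f,f) dμ_{β,W,L}`.
MECHANISM: `HeatBathPoincareBall.heatBathPoincare_onBall` (Glauber gap of the member) ∘ `LangevinPoincare.dirichlet_eq_two_mul_condVariance` (DLR, abstract)
∘ the member's one-link step `condVariance_le_onBall`: the member's heat bath at `ℓ` is the Wilson one-link law `ν_{B_U}` re-weighted by `e^{−h}` with
`osc h ≤ a(ℓ)` (`siteLaw_perturbedTorusSpec_thooft`, `localTilt_sub_le_oscLoad`), so the one-link Bakry–Émery inequality of `LangevinPoincare.section_variance_le`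
survives with the Holley–Stroock factor `e^{a(ℓ)}` (`variance_tilted_le_of_osc`, abstract: a Poincaré-type bound `K Var_ν(ψ) ≤ ∫ G dν` passes to `ν.tilted h`
with the factor `e^{sup h − inf h}`).  0 sorry, 0 definitions.  «Spectral gap ≥ K» below is the standard READING of the Poincaré inequality with constant K⁻¹ for the Dirichlet
form ∫Γ (SZZ (1.6)); no generator / semigroup object is constructed in the tree.
References: R. Holley, D. Stroock, J. Stat. Phys. 46 (1987) 1159; H. Shen, R. Zhu, X. Zhu, CMP 400 (2023) 805; L. Wu, Ann. Probab. 34 (2006) 1960.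
Everything here is proved. [folklore]
-/

noncomputable section

open scoped Matrix ComplexConjugate BigOperators Matrix.Norms.Frobenius ContDiff Topology ProbabilityTheory
open Matrix Complex Finset MeasureTheory Filter ProbabilityTheory Function Real
open Literature.Probability.LatticeModels Literature.Probability.LatticeModels.DobrushinMetric
open Literature.MathematicalPhysics.QuantumFieldTheory
open Literature.MathematicalPhysics.QuantumLattice (fundamentalRep continuous_fundamentalRep)
open Literature.MathematicalPhysics.QuantumFieldTheory.SUNBakryEmery (FrameIdx frame haarSU pot)
open Literature.MathematicalPhysics.QuantumFieldTheory.Balaban1983to89.StrongCouplingTorusWindow (tField matrixOpNorm_tField_le wilsonPlaqWeight)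
open Literature.MathematicalPhysics.QuantumFieldTheory.Balaban1983to89.StrongCouplingDobrushinWindow (OneLinkKRModulus)
open Summit.Ventures.YMGap.LatticeBakryEmery
open Summit.QuantumFields.YangMills.Theorems.StrongPinningPoincare
open Summit.Ventures.YMGap.RobustBall.HeatBathPoincareBall (heatBathPoincare_onBall)

namespace Summit.Ventures.YMGap.RobustBall.LangevinPoincare


/-! ### The member's conditional variances and the Langevin Poincaré inequality uniformly on the torus ball -/

section Ball

variable {d N L : ℕ} [NeZero L]

/-- **The conditional variance of a smooth observable in one link under a MEMBER's heat bath** `ν^W_ℓ(· | U) = ν_{B_U}.tilted(−h)`, `osc h ≤ a(ℓ)`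
(`siteLaw_perturbedTorusSpec_thooft`, `localTilt_sub_le_oscLoad`): for `K₀ = N/2 − 2(d−1)|β| > 0` (dimension `d ≥ 1`) and torus side `≥ 2`,
`Var_{ν^W_ℓ(·|U)}(g ↦ f(U[ℓ ↦ g])) ≤ e^{a(ℓ)} K₀⁻¹ ∫ ∑_α (D_{single_ℓ Y_α} f (U[ℓ ↦ g]))² dν^W_ℓ(g | U)`. [folklore] -/
theorem condVariance_le_onBall (hd : 1 ≤ d) (hN : 1 ≤ N) (β : ℝ) (hK₀ : 0 < (N : ℝ) / 2 - 2 * ((d : ℝ) - 1) * |β|) (hL : 1 < L)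
    {f : Cfg (Edge d L) N → ℝ} (hf : ContDiff ℝ ∞ f) {W : Perturbation d L N} (w : LoadWitness W) (ℓ : Edge d L)
    (U : GaugeConfig d L (SUN N)) :
    ∫ g, (f (emb (update U ℓ g)) - ∫ g', f (emb (update U ℓ g'))
        ∂((haarProbability (SUN N)).tilted fun g'' => torusLogWeight (wilsonPlaqWeight N β) (update U ℓ g'') - W.total (update U ℓ g''))) ^ 2
        ∂((haarProbability (SUN N)).tilted fun g'' => torusLogWeight (wilsonPlaqWeight N β) (update U ℓ g'') - W.total (update U ℓ g'')) ≤
      Real.exp (w.oscLoad 0 ℓ) * ((N : ℝ) / 2 - 2 * ((d : ℝ) - 1) * |β|)⁻¹ *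
        ∫ g, ∑ α : FrameIdx N, algD (lk ℓ (frame α)) f (emb (update U ℓ g)) ^ 2
          ∂((haarProbability (SUN N)).tilted fun g'' => torusLogWeight (wilsonPlaqWeight N β) (update U ℓ g'') - W.total (update U ℓ g'')) := by
  have hN0 : N ≠ 0 := by omega
  have hNpos : (0 : ℝ) < N := by exact_mod_cast Nat.pos_of_ne_zero hN0
  rw [← siteLaw_perturbedTorusSpec_eq_tilted_haar W β ℓ U, siteLaw_perturbedTorusSpec_thooft W β hL hN ℓ U]
  simp_rw [emb_update]
  set B := tField β ℓ U with hBdef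
  have hB : matrixOpNorm B ≤ |β| / N * (2 * ((d : ℝ) - 1)) := matrixOpNorm_tField_le (L := L) hd hN β ℓ U
  have hK1 : (N : ℝ) / 2 - 2 * ((d : ℝ) - 1) * |β| ≤ (N : ℝ) / 2 - N * matrixOpNorm B := by
    have : (N : ℝ) * matrixOpNorm B ≤ N * (|β| / N * (2 * ((d : ℝ) - 1))) := mul_le_mul_of_nonneg_left hB hNpos.le
    have e : (N : ℝ) * (|β| / N * (2 * ((d : ℝ) - 1))) = 2 * ((d : ℝ) - 1) * |β| := by field_simp
    linarith
  have hK1pos : 0 < (N : ℝ) / 2 - N * matrixOpNorm B := lt_of_lt_of_le hK₀ hK1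
  -- the Wilson one-link law `ν_B` and the one-link Bakry–Émery inequality for the section
  set ν : Measure (SUN N) := (haarSU N).tilted fun g : SUN N => (N : ℝ) * ((g : Matrix (Fin N) (Fin N) ℂ) * B).trace.re with hν
  have hwc : Continuous fun g : SUN N => Real.exp (pot (N : ℝ) B g) :=
    Real.continuous_exp.comp (SUNBakryEmery.continuous_restrict (SUNBakryEmery.contDiff_pot _ B))
  haveI : IsProbabilityMeasure ν := isProbabilityMeasure_tilted (SUNBakryEmery.integrable_of_continuous_SUN hwc _)
  have hsec := section_variance_le hN0 hf (emb U) ℓ B hK1pos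
  -- the section and the block are bounded continuous on `SU(N)`
  have hbddSU : ∀ {φ : SUN N → ℝ}, Continuous φ → ∃ M : ℝ, ∀ g, |φ g| ≤ M := fun hφ => by
    obtain ⟨C, hC⟩ := (isCompact_univ (X := SUN N)).exists_bound_of_continuousOn hφ.continuousOn
    exact ⟨C, fun g => by simpa [Real.norm_eq_abs] using hC g (Set.mem_univ _)⟩
  have hψc : Continuous fun g : SUN N => f (update (emb U) ℓ (g : Matrix (Fin N) (Fin N) ℂ)) :=
    SUNBakryEmery.continuous_restrict (contDiff_section hf (emb U) ℓ)
  obtain ⟨Mψ, hMψ⟩ := hbddSU hψc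
  have hblk : Continuous fun Q : Cfg (Edge d L) N => ∑ α : FrameIdx N, algD (lk ℓ (frame α)) f Q ^ 2 :=
    continuous_finsetSum _ fun α _ => (contDiff_algD hf _).continuous.pow 2
  have hGc : Continuous fun g : SUN N => ∑ α : FrameIdx N, algD (lk ℓ (frame α)) f (update (emb U) ℓ (g : Matrix (Fin N) (Fin N) ℂ)) ^ 2 :=
    hblk.comp (continuous_const.update ℓ continuous_subtype_val)
  obtain ⟨MG, hMG⟩ := hbddSU hGc
  -- the member's re-weighting `−h`, `osc h ≤ a(ℓ)`
  obtain ⟨Mt, hMt⟩ := exists_abs_localTilt_le W ℓ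
  have hHS := variance_tilted_le_of_osc ν (h := fun g => -localTilt W ℓ U g) (measurable_localTilt W ℓ U).neg (Bh := Mt)
    (fun g => by rw [abs_neg]; exact hMt U g) (δ := w.oscLoad 0 ℓ) (fun a b => by linarith [localTilt_sub_le_oscLoad w ℓ U b a])
    hψc.measurable hMψ hGc.measurable (fun g => Finset.sum_nonneg fun α _ => sq_nonneg _) hMG hK1pos.le hsec
  -- unpack
  set ν' : Measure (SUN N) := ν.tilted fun g => -localTilt W ℓ U g with hν'
  have hti : Integrable (fun g => Real.exp (-localTilt W ℓ U g)) ν := by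
    refine Integrable.of_bound (measurable_localTilt W ℓ U).neg.exp.aestronglyMeasurable (Real.exp Mt) (ae_of_all _ fun g => ?_)
    rw [Real.norm_eq_abs, abs_exp]
    exact Real.exp_le_exp.2 ((neg_le_abs _).trans (hMt U g))
  haveI : IsProbabilityMeasure ν' := isProbabilityMeasure_tilted hti
  have hvar : Var[fun g : SUN N => f (update (emb U) ℓ (g : Matrix (Fin N) (Fin N) ℂ)); ν'] = ∫ g, (f (update (emb U) ℓ
      (g : Matrix (Fin N) (Fin N) ℂ)) - ∫ g', f (update (emb U) ℓ (g' : Matrix (Fin N) (Fin N) ℂ)) ∂ν') ^ 2 ∂ν' :=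
    variance_eq_integral hψc.measurable.aemeasurable
  have hG0 : 0 ≤ ∫ g, ∑ α : FrameIdx N, algD (lk ℓ (frame α)) f (update (emb U) ℓ (g : Matrix (Fin N) (Fin N) ℂ)) ^ 2 ∂ν' :=
    integral_nonneg fun g => Finset.sum_nonneg fun α _ => sq_nonneg _
  show ∫ g, (f (update (emb U) ℓ (g : Matrix (Fin N) (Fin N) ℂ)) - ∫ g', f (update (emb U) ℓ (g' : Matrix (Fin N) (Fin N) ℂ)) ∂ν') ^ 2 ∂ν' ≤
    Real.exp (w.oscLoad 0 ℓ) * ((N : ℝ) / 2 - 2 * ((d : ℝ) - 1) * |β|)⁻¹ *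
      ∫ g, ∑ α : FrameIdx N, algD (lk ℓ (frame α)) f (update (emb U) ℓ (g : Matrix (Fin N) (Fin N) ℂ)) ^ 2 ∂ν'
  rw [← hvar, mul_assoc, ← div_eq_inv_mul, mul_div_assoc', le_div_iff₀ hK₀]
  calc Var[fun g : SUN N => f (update (emb U) ℓ (g : Matrix (Fin N) (Fin N) ℂ)); ν'] * ((N : ℝ) / 2 - 2 * ((d : ℝ) - 1) * |β|)
      ≤ Var[fun g : SUN N => f (update (emb U) ℓ (g : Matrix (Fin N) (Fin N) ℂ)); ν'] * ((N : ℝ) / 2 - N * matrixOpNorm B) :=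
        mul_le_mul_of_nonneg_left hK1 (variance_nonneg _ _)
    _ ≤ _ := by rw [mul_comm]; exact hHS

/-- ★★★ **THE LANGEVIN (GRADIENT-FORM) POINCARÉ INEQUALITY UNIFORMLY ON THE TORUS BALL AND IN THE VOLUME** (dimension `d ≥ 1`, tree coupling `β`,
torus side `≥ 2`): for a member `W` with a load witness of per-link oscillation load `≤ ε₀`, self-Lipschitz load `≤ ε₁` and column cross-Lipschitz
load `≤ ε₂`, a modulus `OneLinkKRModulus N R K` on `R ≥ 2(d−1)|β|/N`, `c := K e^{ε₀}(1 + 2√N ε₁)(|β|/N)·6(d−1) + √N ε₂ < 1` and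
`K₀ := N/2 − 2(d−1)|β| > 0`, every smooth `f` of the link matrices has `Var_{μ_{β,W,L}}(f) ≤ e^{ε₀} ((1 − c)K₀)⁻¹ ∫ Γ(f,f) dμ_{β,W,L}`: the member's
Langevin dynamics has spectral gap `≥ e^{−ε₀}(1 − c)K₀`, uniformly in the member and the volume. [folklore] -/
theorem variance_le_integral_Gam_onBall (hd : 1 ≤ d) (hN : 1 ≤ N) (hL : 1 < L) {β R K : ℝ} (hK : 0 ≤ K)
    (hR : |β| / N * (2 * ((d : ℝ) - 1)) ≤ R) (hmod : OneLinkKRModulus N R K) {W : Perturbation d L N} (w : LoadWitness W) {ε₀ ε₁ ε₂ c : ℝ}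
    (ha : ∀ e, w.oscLoad 0 e ≤ ε₀) (hs : ∀ e, w.selfLipLoad 0 e ≤ ε₁) (hcol : ∀ y, ∑ e ∈ univ.erase y, w.crossLip 0 e y ≤ ε₂)
    (hc : K * Real.exp ε₀ * (1 + 2 * Real.sqrt N * ε₁) * (|β| / N) * (6 * (d - 1 : ℕ)) + Real.sqrt N * ε₂ ≤ c) (hc1 : c < 1)
    (hK₀ : 0 < (N : ℝ) / 2 - 2 * ((d : ℝ) - 1) * |β|) {f : Cfg (Edge d L) N → ℝ} (hf : ContDiff ℝ ∞ f) :
    Var[fun U => f (emb U); W.perturbedMeasure (fundamentalRep (Fin N)) β] ≤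
      Real.exp ε₀ * ((1 - c) * ((N : ℝ) / 2 - 2 * ((d : ℝ) - 1) * |β|))⁻¹ *
        ∫ U, Gam f f (emb U) ∂(W.perturbedMeasure (fundamentalRep (Fin N)) β) := by
  classical
  set K₀ : ℝ := (N : ℝ) / 2 - 2 * ((d : ℝ) - 1) * |β| with hK₀def
  set μ : Measure (GaugeConfig d L (SUN N)) := W.perturbedMeasure (fundamentalRep (Fin N)) β with hμdef
  haveI : IsProbabilityMeasure μ := isProbabilityMeasure_perturbedMeasure W β
  have hc0 : 0 < 1 - c := by linarith
  have hbdd : ∀ {φ : GaugeConfig d L (SUN N) → ℝ}, Continuous φ → ∃ M : ℝ, ∀ U, |φ U| ≤ M := fun hφ => by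
    obtain ⟨C, hC⟩ := (isCompact_univ (X := GaugeConfig d L (SUN N))).exists_bound_of_continuousOn hφ.continuousOn
    exact ⟨C, fun U => by simpa [Real.norm_eq_abs] using hC U (Set.mem_univ _)⟩
  -- the observable `F = f ∘ emb`
  set F : GaugeConfig d L (SUN N) → ℝ := fun U => f (emb U) with hFdef
  have hFc : Continuous F := hf.continuous.comp continuous_emb
  have hFm : Measurable F := hFc.measurable
  obtain ⟨M, hM⟩ := hbdd hFc
  -- (1) the member's heat-bath Poincaré inequality
  have hHB := heatBathPoincare_onBall hd hN hL hK hR hmod w ha hs hcol hc hc1 F hFm ⟨M, hM⟩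
  -- `μ` as a tilted product measure with bounded measurable log-density `V = −β S_W − W`
  set V : GaugeConfig d L (SUN N) → ℝ := fun U => torusLogWeight (wilsonPlaqWeight N β) U - W.total U with hV
  have hVm : Measurable V := measurable_perturbedTorusEnergy W β
  obtain ⟨B₁, hVb⟩ := exists_abs_perturbedTorusEnergy_le W β
  have hμ : μ = (Measure.pi fun _ : Edge d L => haarProbability (SUN N)).tilted V := perturbedMeasure_eq_tilted W β
  have hblkc : ∀ ℓ : Edge d L, Continuous fun U : GaugeConfig d L (SUN N) => ∑ α : FrameIdx N, algD (lk ℓ (frame α)) f (emb U) ^ 2 :=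
    fun ℓ => continuous_finsetSum _ fun α _ => ((contDiff_algD hf _).continuous.comp continuous_emb).pow 2
  -- (2)+(3) PER LINK
  have key : ∀ ℓ : Edge d L,
      ∫ U, ∫ g, (F U - F (update U ℓ g)) ^ 2 ∂((haarProbability (SUN N)).tilted fun g' => V (update U ℓ g')) ∂μ ≤
        2 * (Real.exp ε₀ * K₀⁻¹) * ∫ U, ∑ α : FrameIdx N, algD (lk ℓ (frame α)) f (emb U) ^ 2 ∂μ := by
    intro ℓ
    obtain ⟨Mb, hMb⟩ := hbdd (hblkc ℓ)
    rw [hμ, dirichlet_eq_two_mul_condVariance (haarProbability (SUN N)) hVm hVb ℓ hFm hM, ← hμ, mul_assoc]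
    refine mul_le_mul_of_nonneg_left ?_ (by norm_num)
    have hDLR := HeatBath.integral_heatBath (haarProbability (SUN N)) hVm hVb ℓ (hblkc ℓ).measurable hMb
    rw [← hμ] at hDLR
    rw [← hDLR, ← integral_const_mul]
    set P : GaugeConfig d L (SUN N) → ℝ := fun y => ∫ g', F (update y ℓ g') ∂((haarProbability (SUN N)).tilted fun g'' => V (update y ℓ g''))
      with hP
    have hPupd : ∀ y g, P (update y ℓ g) = P y := fun y g => by simp only [hP, update_idem]
    have hh : Measurable fun y => (F y - P y) ^ 2 := (hFm.sub (HeatBath.measurable_heatBath (haarProbability (SUN N)) hVm ℓ hFm)).pow_const 2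
    have hhb : ∀ y, |(F y - P y) ^ 2| ≤ (2 * M) ^ 2 := fun y => by
      rw [abs_pow]
      refine pow_le_pow_left₀ (abs_nonneg _) ((abs_sub _ _).trans ?_) 2
      calc _ ≤ M + M := add_le_add (hM y) (HeatBath.abs_heatBath_le _ hVm hVb y ℓ hM)
        _ = 2 * M := by ring
    have hI1 := integrable_heatBath (haarProbability (SUN N)) hVm hVb ℓ hh hhb
    simp only [hPupd] at hI1
    rw [← hμ] at hI1
    have hI2 := (integrable_heatBath (haarProbability (SUN N)) hVm hVb ℓ (hblkc ℓ).measurable hMb).const_mul (Real.exp ε₀ * K₀⁻¹)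
    rw [← hμ] at hI2
    refine integral_mono hI1 hI2 fun U => (condVariance_le_onBall hd hN β hK₀ hL hf w ℓ U).trans ?_
    exact mul_le_mul_of_nonneg_right (mul_le_mul_of_nonneg_right (Real.exp_le_exp.2 (ha ℓ)) (inv_pos.2 hK₀).le)
      (integral_nonneg fun g => Finset.sum_nonneg fun α _ => sq_nonneg _)
  -- SUM OVER LINKS
  have hsum : ∑ ℓ : Edge d L, ∫ U, ∫ g, (F U - F (update U ℓ g)) ^ 2
        ∂((haarProbability (SUN N)).tilted fun g' => V (update U ℓ g')) ∂μ ≤ 2 * (Real.exp ε₀ * K₀⁻¹) * ∫ U, Gam f f (emb U) ∂μ := by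
    calc _ ≤ ∑ ℓ : Edge d L, 2 * (Real.exp ε₀ * K₀⁻¹) * ∫ U, ∑ α : FrameIdx N, algD (lk ℓ (frame α)) f (emb U) ^ 2 ∂μ :=
          Finset.sum_le_sum fun ℓ _ => key ℓ
      _ = 2 * (Real.exp ε₀ * K₀⁻¹) * ∫ U, Gam f f (emb U) ∂μ := by
          rw [← Finset.mul_sum, ← integral_finsetSum _ fun ℓ _ => integrable_of_continuous_PSU (hblkc ℓ) μ]
          congr 1
          refine integral_congr_ae (ae_of_all _ fun U => ?_)
          simp only [Gam_eq_sum_blocks]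
  -- ASSEMBLY
  calc Var[F; μ] ≤ (2 * (1 - c))⁻¹ * ∑ ℓ : Edge d L, ∫ U, ∫ g, (F U - F (update U ℓ g)) ^ 2
        ∂((haarProbability (SUN N)).tilted fun g' => V (update U ℓ g')) ∂μ := hHB
    _ ≤ (2 * (1 - c))⁻¹ * (2 * (Real.exp ε₀ * K₀⁻¹) * ∫ U, Gam f f (emb U) ∂μ) := mul_le_mul_of_nonneg_left hsum (by positivity)
    _ = Real.exp ε₀ * ((1 - c) * K₀)⁻¹ * ∫ U, Gam f f (emb U) ∂μ := by
        field_simp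

/-- ★★ **THE WILSON ACTION IN EVERY DIMENSION** (the zero member, zero loads): `d ≥ 1`, tree coupling `β`, `OneLinkKRModulus N R K` on `R ≥ 2(d−1)|β|/N`,
`c := 6(d−1)(|β|/N)K < 1`, `K₀ := N/2 − 2(d−1)|β| > 0` ⇒ on every torus `(ℤ/L)^d`, `L ≥ 2`, for every smooth `f` of the link matrices,
`Var_{μ_{β,L}}(f) ≤ ((1 − c)K₀)⁻¹ ∫ Γ(f,f) dμ_{β,L}` (`LangevinPoincare.variance_le_integral_Gam_of_oneLinkKRModulus` is the case `d = 4`). [folklore] -/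
theorem variance_le_integral_Gam_dim (hd : 1 ≤ d) (hN : 1 ≤ N) (hL : 1 < L) {β R K c : ℝ} (hK : 0 ≤ K)
    (hR : |β| / N * (2 * ((d : ℝ) - 1)) ≤ R) (hmod : OneLinkKRModulus N R K) (hc : K * (|β| / N) * (6 * (d - 1 : ℕ)) ≤ c) (hc1 : c < 1)
    (hK₀ : 0 < (N : ℝ) / 2 - 2 * ((d : ℝ) - 1) * |β|) {f : Cfg (Edge d L) N → ℝ} (hf : ContDiff ℝ ∞ f) :
    Var[fun U => f (emb U); wilsonMeasure (d := d) (L := L) (fundamentalRep (Fin N)) β] ≤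
      ((1 - c) * ((N : ℝ) / 2 - 2 * ((d : ℝ) - 1) * |β|))⁻¹ * ∫ U, Gam f f (emb U) ∂(wilsonMeasure (d := d) (L := L) (fundamentalRep (Fin N)) β) := by
  -- the zero member with the zero witness
  let w : LoadWitness (0 : Perturbation d L N) :=
    ⟨fun _ _ => 0, fun _ _ => 0, fun X => ⟨fun _ => le_rfl, fun y σ τ _ => by simp⟩, fun X => ⟨fun _ => le_rfl, fun y σ τ _ => by simp⟩⟩
  have ha : ∀ e, w.oscLoad 0 e ≤ 0 := fun e => by simp [w, LoadWitness.oscLoad]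
  have hs : ∀ e, w.selfLipLoad 0 e ≤ 0 := fun e => by simp [w, LoadWitness.selfLipLoad]
  have hcol : ∀ y, ∑ e ∈ univ.erase y, w.crossLip 0 e y ≤ 0 := fun y => by simp [w, LoadWitness.crossLip]
  have hc' : K * Real.exp 0 * (1 + 2 * Real.sqrt N * 0) * (|β| / N) * (6 * (d - 1 : ℕ)) + Real.sqrt N * 0 ≤ c := by
    simpa using hc
  have key := variance_le_integral_Gam_onBall hd hN hL hK hR hmod w ha hs hcol hc' hc1 hK₀ hf
  rwa [QuasiLocalGaugePerturbation.perturbedMeasure_zero, Real.exp_zero, one_mul] at key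

/-- ★★ **`SU(2)`, `d = 3`, HYPOTHESIS-FREE (Wilson action, quarter modulus): THE LANGEVIN POINCARÉ INEQUALITY UNIFORMLY IN THE VOLUME ON `0 ≤ β_W < 1/3`**
(tree coupling `β_W/2`; `c = 3β_W`, `K₀ = 1 − 2β_W`): on every torus `(ℤ/L)³`, `L ≥ 2`, `Var_μ(f) ≤ ((1 − 3β_W)(1 − 2β_W))⁻¹ ∫ Γ(f,f) dμ` — the Bakry–Émery window
for the same inequality in `d = 3` is `β_W < 1/6` ('t Hooft `|b| < 1/24`). [folklore] -/
theorem su2_variance_le_integral_Gam_dim3 {βW : ℝ} (h0 : 0 ≤ βW) (h : βW < 1 / 3) (hL : 1 < L) {f : Cfg (Edge 3 L) 2 → ℝ} (hf : ContDiff ℝ ∞ f) :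
    Var[fun U => f (emb U); wilsonMeasure (d := 3) (L := L) (fundamentalRep (Fin 2)) (βW / 2)] ≤
      ((1 - 3 * βW) * (1 - 2 * βW))⁻¹ * ∫ U, Gam f f (emb U) ∂(wilsonMeasure (d := 3) (L := L) (fundamentalRep (Fin 2)) (βW / 2)) := by
  have habs : |βW / 2| = βW / 2 := abs_of_nonneg (by positivity)
  have habs' : |βW / 2| / ((2 : ℕ) : ℝ) = βW / 4 := by rw [habs]; push_cast; ring
  have key := variance_le_integral_Gam_dim (d := 3) (N := 2) (L := L) (by norm_num) (by norm_num) hL (β := βW / 2) zero_le_one (R := βW)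
    (by rw [habs']; norm_num) (SlabAreaLawDimensions.su2_oneLinkKRModulus_of_le_one (by linarith)) (c := 3 * βW)
    (by rw [habs']; norm_num; linarith) (by linarith) (by rw [habs]; push_cast; linarith) hf
  have e : ((2 : ℕ) : ℝ) / 2 - 2 * (((3 : ℕ) : ℝ) - 1) * |βW / 2| = 1 - 2 * βW := by rw [habs]; push_cast; ring
  rw [e] at key
  exact key

/-- ★★ **`SU(2)`, `d = 4` (quarter modulus): THE LANGEVIN POINCARÉ INEQUALITY UNIFORMLY ON THE TORUS BALL**, tree coupling `β_W/2`, `0 ≤ β_W < 1/3`: for a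
member with per-link loads `a ≤ ε₀`, `ℓ_s ≤ ε₁`, column cross load `≤ ε₂` and `c := (9β_W/2) e^{ε₀}(1 + 2√2 ε₁) + √2 ε₂ < 1`,
`Var_{μ_{β,W,L}}(f) ≤ e^{ε₀} ((1 − c)(1 − 3β_W))⁻¹ ∫ Γ(f,f) dμ_{β,W,L}` on every torus of side `≥ 2`. [folklore] -/
theorem su2_variance_le_integral_Gam_onBall {βW : ℝ} (h0 : 0 ≤ βW) (h13 : βW < 1 / 3) (hL : 1 < L) {W : Perturbation 4 L 2}
    (w : LoadWitness W) {ε₀ ε₁ ε₂ c : ℝ} (ha : ∀ e, w.oscLoad 0 e ≤ ε₀) (hs : ∀ e, w.selfLipLoad 0 e ≤ ε₁)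
    (hcol : ∀ y, ∑ e ∈ univ.erase y, w.crossLip 0 e y ≤ ε₂)
    (hc : 9 * βW / 2 * Real.exp ε₀ * (1 + 2 * Real.sqrt 2 * ε₁) + Real.sqrt 2 * ε₂ ≤ c) (hc1 : c < 1)
    {f : Cfg (Edge 4 L) 2 → ℝ} (hf : ContDiff ℝ ∞ f) :
    Var[fun U => f (emb U); W.perturbedMeasure (fundamentalRep (Fin 2)) (βW / 2)] ≤
      Real.exp ε₀ * ((1 - c) * (1 - 3 * βW))⁻¹ * ∫ U, Gam f f (emb U) ∂(W.perturbedMeasure (fundamentalRep (Fin 2)) (βW / 2)) := by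
  have habs : |βW / 2| = βW / 2 := abs_of_nonneg (by positivity)
  have habs' : |βW / 2| / ((2 : ℕ) : ℝ) = βW / 4 := by rw [habs]; push_cast; ring
  have key := variance_le_integral_Gam_onBall (d := 4) (N := 2) (L := L) (by norm_num) (by norm_num) hL (β := βW / 2) zero_le_one
    (R := 3 * βW / 2) (by rw [habs']; norm_num; linarith) (SlabAreaLawDimensions.su2_oneLinkKRModulus_of_le_one (by linarith)) w ha hs hcol
    (c := c) ?_ hc1 (by rw [habs]; push_cast; linarith) hf
  · have e : ((2 : ℕ) : ℝ) / 2 - 2 * (((4 : ℕ) : ℝ) - 1) * |βW / 2| = 1 - 3 * βW := by rw [habs]; push_cast; ring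
    rw [e] at key
    exact key
  · rw [habs']; norm_num
    nlinarith [Real.exp_pos ε₀, Real.sqrt_nonneg (2 : ℝ), hc, mul_nonneg (Real.exp_pos ε₀).le (Real.sqrt_nonneg (2 : ℝ))]

/-- ★★ **THE SPRINT LOADS, EVERY `0 ≤ β_W ≤ 1/8`**: for `SU(2)`, `d = 4`, every member with per-link loads `(a, ℓ_s, column Λ) ≤ (1/100, 1/500, 1/500)`, every
torus of side `≥ 2` and every smooth `f` of the link matrices: `Var_{μ_{β,W,L}}(f) ≤ (65/16) ∫ Γ(f,f) dμ_{β,W,L}` — Langevin spectral gap `≥ 16/65`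
uniformly on this ball and in the volume (`c ≤ 3/5`, `K₀ ≥ 5/8`, `e^{1/100} ≤ 100/99`). [folklore] -/
theorem su2_variance_le_integral_Gam_onBall_oneEighth {βW : ℝ} (h0 : 0 ≤ βW) (h8 : βW ≤ 1 / 8) (hL : 1 < L) {W : Perturbation 4 L 2}
    (w : LoadWitness W) (ha : ∀ e, w.oscLoad 0 e ≤ 1 / 100) (hs : ∀ e, w.selfLipLoad 0 e ≤ 1 / 500)
    (hcol : ∀ y, ∑ e ∈ univ.erase y, w.crossLip 0 e y ≤ 1 / 500) {f : Cfg (Edge 4 L) 2 → ℝ} (hf : ContDiff ℝ ∞ f) :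
    Var[fun U => f (emb U); W.perturbedMeasure (fundamentalRep (Fin 2)) (βW / 2)] ≤
      (65 / 16 : ℝ) * ∫ U, Gam f f (emb U) ∂(W.perturbedMeasure (fundamentalRep (Fin 2)) (βW / 2)) := by
  have hexp : Real.exp (1 / 100 : ℝ) ≤ 1 / (1 - 1 / 100) := Real.exp_bound_div_one_sub_of_interval (by norm_num) (by norm_num)
  have hsqrt : Real.sqrt 2 ≤ 3 / 2 := by
    rw [show (3 / 2 : ℝ) = Real.sqrt ((3 / 2) ^ 2) by rw [Real.sqrt_sq (by norm_num)]]
    exact Real.sqrt_le_sqrt (by norm_num)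
  have hc : 9 * βW / 2 * Real.exp (1 / 100 : ℝ) * (1 + 2 * Real.sqrt 2 * (1 / 500)) + Real.sqrt 2 * (1 / 500) ≤ 3 / 5 := by
    nlinarith [Real.exp_pos (1 / 100 : ℝ), Real.sqrt_nonneg (2 : ℝ), mul_nonneg h0 (Real.exp_pos (1 / 100 : ℝ)).le,
      mul_nonneg (mul_nonneg h0 (Real.exp_pos (1 / 100 : ℝ)).le) (Real.sqrt_nonneg (2 : ℝ))]
  haveI := isProbabilityMeasure_perturbedMeasure W (βW / 2)
  have key := su2_variance_le_integral_Gam_onBall h0 (by linarith) hL w ha hs hcol hc (by norm_num) hf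
  refine key.trans (mul_le_mul_of_nonneg_right ?_ (integral_nonneg fun U => Gam_self_nonneg f (emb U)))
  have h1 : ((1 - 3 / 5) * (1 - 3 * βW))⁻¹ ≤ (4 : ℝ) := by
    rw [inv_le_comm₀ (by nlinarith) (by norm_num)]
    nlinarith
  calc Real.exp (1 / 100) * ((1 - 3 / 5) * (1 - 3 * βW))⁻¹ ≤ (1 / (1 - 1 / 100)) * 4 :=
        mul_le_mul hexp h1 (inv_pos.2 (by nlinarith)).le (by norm_num)
    _ ≤ 65 / 16 := by norm_num

end Ball

end Summit.Ventures.YMGap.RobustBall.LangevinPoincare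

end
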